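import Summits.KontsevichZagierPeriods.KontsevichZagierPeriods.Theorems.UnfoldedStokesStokesGenerationFibrewiseRungScaling
import Summits.KontsevichZagierPeriods.KontsevichZagierPeriods.Theorems.UnfoldedStokesStokesGenerationFibrewiseClosureCongr

/-!
# `StokesGeneration` (stmt-KontsevichZagierPeriods-3586) — line `fibrewise_stokes`, stub `stub_paramLandenPartOne`

Registered rung stub PL1 (rung 25, LANDEN'S IDENTITY WITH A PARAMETER, wave 6) of the line `fibrewise_stokes` of
the crux `StokesGeneration` (route UnfoldedStokes): the two-element fibrewise-Stokes certificate of the `Li₂(au)`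
part of the homotopy `a ↦ au`, run UNIFORMLY in a silent parameter. On the closed cube `[0,1]⁴` (`s = x 0`,
`t = x 1`, `u = x 2`, silent `v = x 3`), for one-variable `ℚ`-semialgebraic `C¹` functions `a`, `γ` on a
neighbourhood `(−δ, 1 + δ)` of `[0,1]` with `a < 1` there, the function
`γ(v) · (a(v)/(1 − a(v) u s) − a(v)/(1 − a(v) s t))` is fibrewise-Stokes decomposable (`FibStokesDecomposable 4`,
`Theorems/UnfoldedStokesDefs.lean`). This is the fixed-parameter certificate `stub_landenPartOne` (rung 18) with
the algebraic constant `a` replaced by the value `a(v)` and an overall coefficient `γ(v)`, both constant along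
every fibre direction used.

Proof. Two fibrewise Stokes elements on the same cube, no kink sets, no transcendence input, none along `v`:
* along `u` (direction `2`) with primitive `G₀ = γ a u/(1 − a u s t)`, fibre derivative `D₀ = γ a/(1 − a u s t)²`
  and faces `G₀|_{u=1} − G₀|_{u=0} = γ a/(1 − a s t)`;
* along `t` (direction `1`) with primitive `G₁ = −γ a t/(1 − a u s t)`, fibre derivative `D₁ = −γ a/(1 − a u s t)²`
  and faces `G₁|_{t=1} − G₁|_{t=0} = −γ a/(1 − a u s)`
(`a = a(v)`, `γ = γ(v)` throughout). The two integrands `Dⱼ − (faces)` are carried by closed-cube representations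
(`exists_cubeRep`); the family is decomposable (`fibStokesDecomposable_of_elements`), and its sum equals
`γ (a/(1 − a u s) − a/(1 − a s t))` at every point of the cube (`D₀ + D₁ = 0`), so
`fibStokesDecomposable_congr_off_null` with the empty null set concludes. Semialgebraicity of `x ↦ a (x 3)`,
`x ↦ γ (x 3)` on the cube is the coordinate re-reading `isSemialgebraicFunOn_comp_coord` restricted to the cube
(`[0,1] ⊆ (−δ, 1 + δ)`); continuity comes from `C¹`; all denominators are `> 0` on the closed cube since `a(v) < 1`.

References: D. Zagier, *The dilogarithm function* (2007), §I.2 (Landen's functional equation);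
M. Kontsevich, D. Zagier, *Periods* (2001), §1.2 (rule (3), Newton–Leibniz/Stokes);
J. Bochnak, M. Coste, M.-F. Roy, *Real Algebraic Geometry* (1998), Prop. 2.2.6.
-/

noncomputable section

-- `Summit.KontsevichZagierPeriods.KontsevichZagierPeriods.…` is the tree's mandated layout (single-conjunct summit).
set_option linter.dupNamespace false

namespace Summit.KontsevichZagierPeriods.KontsevichZagierPeriods.Cruxes.StokesGeneration.FibrewiseStokes

open MeasureTheory Set
open Literature.NumberTheory.Transcendental
open Literature.NumberTheory.Transcendental.KZ
open Literature.ModelTheory.ExponentialFields (IsSemialgebraic)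

/-- For `a < 1` and `p ∈ [0,1]` the Landen denominator `1 − a p` is positive. [folklore] -/
private theorem paramLandenPartOne_den_pos {a : ℝ} (ha1 : a < 1) {p : ℝ} (hp : p ∈ Set.Icc (0:ℝ) 1) :
    0 < 1 - a * p := by
  rcases le_or_gt 0 a with ha0 | ha0
  · nlinarith [mul_nonneg ha0 (sub_nonneg.2 hp.2)]
  · nlinarith [mul_nonneg (neg_nonneg.2 ha0.le) hp.1]

/-- **Registered stub `stub_paramLandenPartOne` (rung 25, PL1): the `Li₂(au)` part of the Landen homotopy, with a
silent parameter.** On `[0,1]⁴` (`s = x 0`, `t = x 1`, `u = x 2`, `v = x 3` silent) the two elements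
`E_u[G = γ·au/(1−aust)]`, `E_t[G = −γ·at/(1−aust)]` (`a = a(v) < 1`, `γ = γ(v)` one-variable `ℚ`-semialgebraic
`C¹` functions near `[0,1]`) certify `γ·(a/(1−aus) − a/(1−ast)) ∈ Dec`
(`∂_u[au/(1−aust)] = a/(1−aust)² = ∂_t[at/(1−aust)]`). [cite: Zagier2007Dilogarithm, §I.2] -/
theorem stub_paramLandenPartOne (a γ : ℝ → ℝ) (δ : ℝ) (hδ : 0 < δ)
    (ha : IsSemialgebraicFunOn ℚ {z : Fin 1 → ℝ | z 0 ∈ Set.Ioo (-δ) (1 + δ)} (fun z => a (z 0)))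
    (hγ : IsSemialgebraicFunOn ℚ {z : Fin 1 → ℝ | z 0 ∈ Set.Ioo (-δ) (1 + δ)} (fun z => γ (z 0)))
    (hac : ContDiffOn ℝ 1 a (Set.Ioo (-δ) (1 + δ))) (hγc : ContDiffOn ℝ 1 γ (Set.Ioo (-δ) (1 + δ)))
    (ha1 : ∀ v ∈ Set.Ioo (-δ) (1 + δ), a v < 1) :
    FibStokesDecomposable 4 (fun x => γ (x 3) *
      (a (x 3) / (1 - a (x 3) * x 2 * x 0) - a (x 3) / (1 - a (x 3) * x 0 * x 1))) := by
  classical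
  set C : Set (Fin 4 → ℝ) := Set.pi Set.univ (fun _ : Fin 4 => Set.Icc (0:ℝ) 1) with hC
  have hCsa : IsSemialgebraic ℚ C := by rw [hC, ← cube_eq_pi]; exact isSemialgebraic_cube
  have hCc : IsCompact C := isCompact_univ_pi fun _ => isCompact_Icc
  have hmem : ∀ x ∈ C, ∀ i, x i ∈ Set.Icc (0:ℝ) 1 := fun x hx i => (Set.mem_univ_pi.mp hx) i
  have hupd : ∀ x ∈ C, ∀ (i : Fin 4), ∀ s ∈ Set.Icc (0:ℝ) 1, Function.update x i s ∈ C :=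
    fun x hx i s hs => update_mem_cubePi hx i hs
  have h02 : (0 : Fin 4) ≠ 2 := by decide
  have h12 : (1 : Fin 4) ≠ 2 := by decide
  have h32 : (3 : Fin 4) ≠ 2 := by decide
  have h01 : (0 : Fin 4) ≠ 1 := by decide
  have h21 : (2 : Fin 4) ≠ 1 := by decide
  have h31 : (3 : Fin 4) ≠ 1 := by decide
  have h0I : (0:ℝ) ∈ Set.Icc (0:ℝ) 1 := ⟨le_rfl, zero_le_one⟩
  have h1I : (1:ℝ) ∈ Set.Icc (0:ℝ) 1 := ⟨zero_le_one, le_rfl⟩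
  have hmulI : ∀ u ∈ Set.Icc (0:ℝ) 1, ∀ v ∈ Set.Icc (0:ℝ) 1, u * v ∈ Set.Icc (0:ℝ) 1 :=
    fun u hu v hv => ⟨mul_nonneg hu.1 hv.1, by nlinarith [hu.1, hu.2, hv.1, hv.2]⟩
  -- the silent coordinate `v = x 3` stays in `[0,1] ⊆ (-δ, 1 + δ)`
  have hIcc : Set.Icc (0:ℝ) 1 ⊆ Set.Ioo (-δ) (1 + δ) := fun v hv => ⟨by linarith [hv.1], by linarith [hv.2]⟩
  have hv : ∀ x ∈ C, x 3 ∈ Set.Ioo (-δ) (1 + δ) := fun x hx => hIcc (hmem x hx 3)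
  have ha1' : ∀ x ∈ C, a (x 3) < 1 := fun x hx => ha1 (x 3) (hv x hx)
  -- positivity of the denominators on the closed cube
  have hPpos : ∀ x ∈ C, 0 < 1 - a (x 3) * x 2 * x 0 * x 1 := fun x hx => by
    have := paramLandenPartOne_den_pos (ha1' x hx)
      (hmulI _ (hmulI _ (hmem x hx 2) _ (hmem x hx 0)) _ (hmem x hx 1))
    simpa [mul_assoc] using this
  have hPne : ∀ x ∈ C, 1 - a (x 3) * x 2 * x 0 * x 1 ≠ 0 := fun x hx => (hPpos x hx).ne'
  have hP2ne : ∀ x ∈ C, (1 - a (x 3) * x 2 * x 0 * x 1) ^ 2 ≠ 0 := fun x hx => pow_ne_zero 2 (hPne x hx)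
  -- semialgebraic atoms on `C`: coordinates and the readings of `a`, `γ` along the coordinate `3`
  have hx0 : IsSemialgebraicFunOn ℚ C (fun x => x 0) := isSemialgebraicFunOn_apply hCsa 0
  have hx1 : IsSemialgebraicFunOn ℚ C (fun x => x 1) := isSemialgebraicFunOn_apply hCsa 1
  have hx2 : IsSemialgebraicFunOn ℚ C (fun x => x 2) := isSemialgebraicFunOn_apply hCsa 2
  have hA : IsSemialgebraicFunOn ℚ C (fun x => a (x 3)) :=
    (isSemialgebraicFunOn_comp_coord ha (fun _ : Fin 1 => (3 : Fin 4))).mono (fun x hx => hv x hx) hCsa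
  have hΓ : IsSemialgebraicFunOn ℚ C (fun x => γ (x 3)) :=
    (isSemialgebraicFunOn_comp_coord hγ (fun _ : Fin 1 => (3 : Fin 4))).mono (fun x hx => hv x hx) hCsa
  have hc1 : IsSemialgebraicFunOn ℚ C (fun _ => (1:ℝ)) :=
    isSemialgebraicFunOn_const_of_isAlgebraic hCsa isAlgebraic_one
  have hPsa : IsSemialgebraicFunOn ℚ C (fun x => 1 - a (x 3) * x 2 * x 0 * x 1) :=
    hc1.fun_sub (((hA.fun_mul hx2).fun_mul hx0).fun_mul hx1)
  -- continuity on `C` of the readings and of the denominator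
  have hAc : ContinuousOn (fun x : Fin 4 → ℝ => a (x 3)) C :=
    hac.continuousOn.comp (continuous_apply 3).continuousOn fun x hx => hv x hx
  have hΓc : ContinuousOn (fun x : Fin 4 → ℝ => γ (x 3)) C :=
    hγc.continuousOn.comp (continuous_apply 3).continuousOn fun x hx => hv x hx
  have hPc : ContinuousOn (fun x : Fin 4 → ℝ => 1 - a (x 3) * x 2 * x 0 * x 1) C :=
    continuousOn_const.sub (((hAc.mul (continuous_apply 2).continuousOn).mul
      (continuous_apply 0).continuousOn).mul (continuous_apply 1).continuousOn)
  -- the witnesses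
  obtain ⟨G0, hG0⟩ : ∃ G0 : (Fin 4 → ℝ) → ℝ,
      G0 = fun x => γ (x 3) * (a (x 3) * x 2 / (1 - a (x 3) * x 2 * x 0 * x 1)) := ⟨_, rfl⟩
  obtain ⟨D0, hD0⟩ : ∃ D0 : (Fin 4 → ℝ) → ℝ,
      D0 = fun x => γ (x 3) * (a (x 3) / (1 - a (x 3) * x 2 * x 0 * x 1) ^ 2) := ⟨_, rfl⟩
  obtain ⟨G1, hG1⟩ : ∃ G1 : (Fin 4 → ℝ) → ℝ,
      G1 = fun x => γ (x 3) * (-(a (x 3) * x 1) / (1 - a (x 3) * x 2 * x 0 * x 1)) := ⟨_, rfl⟩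
  obtain ⟨D1, hD1⟩ : ∃ D1 : (Fin 4 → ℝ) → ℝ,
      D1 = fun x => γ (x 3) * -(a (x 3) / (1 - a (x 3) * x 2 * x 0 * x 1) ^ 2) := ⟨_, rfl⟩
  have hG0sa : IsSemialgebraicFunOn ℚ C G0 := by
    rw [hG0]; exact hΓ.fun_mul ((hA.fun_mul hx2).div hPsa hPne)
  have hD0sa : IsSemialgebraicFunOn ℚ C D0 := by
    rw [hD0]; exact hΓ.fun_mul (hA.div (hPsa.fun_pow 2) hP2ne)
  have hG1sa : IsSemialgebraicFunOn ℚ C G1 := by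
    rw [hG1]; exact hΓ.fun_mul ((hA.fun_mul hx1).fun_neg.div hPsa hPne)
  have hD1sa : IsSemialgebraicFunOn ℚ C D1 := by
    rw [hD1]; exact hΓ.fun_mul (hA.div (hPsa.fun_pow 2) hP2ne).fun_neg
  have hG0c : ContinuousOn G0 C := by
    rw [hG0]; exact hΓc.mul ((hAc.mul (continuous_apply 2).continuousOn).div hPc hPne)
  have hD0c : ContinuousOn D0 C := by
    rw [hD0]; exact hΓc.mul (hAc.div (hPc.pow 2) hP2ne)
  have hG1c : ContinuousOn G1 C := by
    rw [hG1]; exact hΓc.mul ((hAc.mul (continuous_apply 1).continuousOn).neg.div hPc hPne)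
  have hD1c : ContinuousOn D1 C := by
    rw [hD1]; exact hΓc.mul (hAc.div (hPc.pow 2) hP2ne).neg
  -- composition with the (semialgebraic, continuous) face maps `x ↦ x[i ↦ t]`, `t ∈ {0, 1}`
  have hface_sa : ∀ {F : (Fin 4 → ℝ) → ℝ}, IsSemialgebraicFunOn ℚ C F → ∀ (i : Fin 4) (t : ℝ), IsAlgebraic ℚ t →
      t ∈ Set.Icc (0:ℝ) 1 → IsSemialgebraicFunOn ℚ C (fun x => F (Function.update x i t)) :=
    fun hF i t ht htI => IsSemialgebraicFunOn.comp_isSemialgebraicMapOn_holds hF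
      (isSemialgebraicMapOn_update_const i ht) fun x hx => hupd x hx i t htI
  have hface_c : ∀ {F : (Fin 4 → ℝ) → ℝ}, ContinuousOn F C → ∀ (i : Fin 4) (t : ℝ), t ∈ Set.Icc (0:ℝ) 1 →
      ContinuousOn (fun x => F (Function.update x i t)) C :=
    fun hF i t htI => hF.comp (continuous_id.update i continuous_const).continuousOn fun x hx => hupd x hx i t htI
  have hcu : ∀ (x : Fin 4 → ℝ) (i : Fin 4), Continuous fun s : ℝ => Function.update x i s :=
    fun x i => continuous_const.update i continuous_id
  -- the two integrands and their representations on the cube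
  obtain ⟨I0, hI0⟩ : ∃ I0 : (Fin 4 → ℝ) → ℝ, I0 = fun x =>
      D0 x - (G0 (Function.update x 2 1) - G0 (Function.update x 2 0)) := ⟨_, rfl⟩
  obtain ⟨I1, hI1⟩ : ∃ I1 : (Fin 4 → ℝ) → ℝ, I1 = fun x =>
      D1 x - (G1 (Function.update x 1 1) - G1 (Function.update x 1 0)) := ⟨_, rfl⟩
  have hI0sa : IsSemialgebraicFunOn ℚ C I0 := by
    rw [hI0]
    exact hD0sa.fun_sub ((hface_sa hG0sa 2 1 isAlgebraic_one h1I).fun_sub (hface_sa hG0sa 2 0 isAlgebraic_zero h0I))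
  have hI1sa : IsSemialgebraicFunOn ℚ C I1 := by
    rw [hI1]
    exact hD1sa.fun_sub ((hface_sa hG1sa 1 1 isAlgebraic_one h1I).fun_sub (hface_sa hG1sa 1 0 isAlgebraic_zero h0I))
  have hI0c : ContinuousOn I0 C := by
    rw [hI0]; exact hD0c.sub ((hface_c hG0c 2 1 h1I).sub (hface_c hG0c 2 0 h0I))
  have hI1c : ContinuousOn I1 C := by
    rw [hI1]; exact hD1c.sub ((hface_c hG1c 1 1 h1I).sub (hface_c hG1c 1 0 h0I))
  obtain ⟨q0, hq0d, hq0i⟩ := exists_cubeRep 4 I0 hI0sa hI0c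
  obtain ⟨q1, hq1d, hq1i⟩ := exists_cubeRep 4 I1 hI1sa hI1c
  -- bounds
  have hbound : ∀ {F : (Fin 4 → ℝ) → ℝ}, ContinuousOn F C → ∃ B : ℝ, ∀ x ∈ C, |F x| ≤ B := fun hF => by
    obtain ⟨B, hB⟩ := hCc.exists_bound_of_continuousOn hF
    exact ⟨B, fun x hx => by simpa [Real.norm_eq_abs] using hB x hx⟩
  -- assemble the two elements
  have hdec : FibStokesDecomposable 4 (fun x => ∑ j, ((![q0, q1] : Fin 2 → IntegralRep 4) j).integrand x) := by
    refine fibStokesDecomposable_of_elements (M := 4) (J := 2) (![2, 1] : Fin 2 → Fin 4)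
      (![G0, G1] : Fin 2 → (Fin 4 → ℝ) → ℝ) (![D0, D1] : Fin 2 → (Fin 4 → ℝ) → ℝ)
      (![q0, q1] : Fin 2 → IntegralRep 4) ?_ ?_
    · refine Fin.forall_fin_two.mpr ⟨?_, ?_⟩
      · -- element 0, along `u = x 2`
        simp only [Matrix.cons_val_zero]
        refine ⟨hG0sa, hD0sa, hbound hG0c, fun x hx => ?_, fun x hx hx2' => ?_⟩
        · show ContinuousOn (fun s : ℝ => G0 (Function.update x 2 s)) (Set.Icc (0:ℝ) 1)
          exact hG0c.comp (hcu x 2).continuousOn fun s hs => hupd x hx 2 s hs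
        · show HasDerivAt (fun s : ℝ => G0 (Function.update x 2 s)) (D0 x) (x 2)
          have hfun : (fun s : ℝ => G0 (Function.update x 2 s)) =
              fun s => γ (x 3) * (a (x 3) * s / (1 - a (x 3) * s * x 0 * x 1)) := by
            funext s; rw [hG0]
            simp only [Function.update_self, Function.update_of_ne h02, Function.update_of_ne h12,
              Function.update_of_ne h32]
          rw [hfun, hD0]
          simp only
          have hnum : HasDerivAt (fun s : ℝ => a (x 3) * s) (a (x 3) * 1) (x 2) :=
            (hasDerivAt_id' (x 2)).const_mul (a (x 3))
          have hden : HasDerivAt (fun s : ℝ => 1 - a (x 3) * s * x 0 * x 1) (-(a (x 3) * 1 * x 0 * x 1)) (x 2) :=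
            ((((hasDerivAt_id' (x 2)).const_mul (a (x 3))).mul_const (x 0)).mul_const (x 1)).const_sub 1
          have hinner : HasDerivAt (fun s : ℝ => a (x 3) * s / (1 - a (x 3) * s * x 0 * x 1))
              (a (x 3) / (1 - a (x 3) * x 2 * x 0 * x 1) ^ 2) (x 2) := by
            refine (hnum.div hden (hPne x hx)).congr_deriv ?_
            field_simp [hPne x hx]
            ring
          exact hinner.const_mul (γ (x 3))
      · -- element 1, along `t = x 1`
        simp only [Matrix.cons_val_one, Matrix.cons_val_zero]
        refine ⟨hG1sa, hD1sa, hbound hG1c, fun x hx => ?_, fun x hx hx1' => ?_⟩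
        · show ContinuousOn (fun s : ℝ => G1 (Function.update x 1 s)) (Set.Icc (0:ℝ) 1)
          exact hG1c.comp (hcu x 1).continuousOn fun s hs => hupd x hx 1 s hs
        · show HasDerivAt (fun s : ℝ => G1 (Function.update x 1 s)) (D1 x) (x 1)
          have hfun : (fun s : ℝ => G1 (Function.update x 1 s)) =
              fun s => γ (x 3) * (-(a (x 3) * s) / (1 - a (x 3) * x 2 * x 0 * s)) := by
            funext s; rw [hG1]
            simp only [Function.update_self, Function.update_of_ne h01, Function.update_of_ne h21,
              Function.update_of_ne h31]
          rw [hfun, hD1]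
          simp only
          have hnum : HasDerivAt (fun s : ℝ => -(a (x 3) * s)) (-(a (x 3) * 1)) (x 1) :=
            ((hasDerivAt_id' (x 1)).const_mul (a (x 3))).neg
          have hden : HasDerivAt (fun s : ℝ => 1 - a (x 3) * x 2 * x 0 * s) (-(a (x 3) * x 2 * x 0 * 1)) (x 1) :=
            ((hasDerivAt_id' (x 1)).const_mul (a (x 3) * x 2 * x 0)).const_sub 1
          have hinner : HasDerivAt (fun s : ℝ => -(a (x 3) * s) / (1 - a (x 3) * x 2 * x 0 * s))
              (-(a (x 3) / (1 - a (x 3) * x 2 * x 0 * x 1) ^ 2)) (x 1) := by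
            refine (hnum.div hden (hPne x hx)).congr_deriv ?_
            field_simp [hPne x hx]
            ring
          exact hinner.const_mul (γ (x 3))
    · refine Fin.forall_fin_two.mpr ⟨?_, ?_⟩
      · simp only [Matrix.cons_val_zero]
        exact ⟨hq0d, fun x _ => by rw [hq0i, hI0]⟩
      · simp only [Matrix.cons_val_one, Matrix.cons_val_zero]
        exact ⟨hq1d, fun x _ => by rw [hq1i, hI1]⟩
  -- the pointwise identity on the cube
  refine fibStokesDecomposable_congr_off_null 4 _ _ ∅
    Literature.ModelTheory.ExponentialFields.isSemialgebraic_empty measure_empty (fun x hx _ => ?_) hdec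
  have hface0 : G0 (Function.update x 2 1) - G0 (Function.update x 2 0) =
      γ (x 3) * (a (x 3) / (1 - a (x 3) * x 0 * x 1)) := by
    rw [hG0]
    simp only [Function.update_self, Function.update_of_ne h02, Function.update_of_ne h12,
      Function.update_of_ne h32, mul_one, mul_zero, zero_div, sub_zero]
  have hface1 : G1 (Function.update x 1 1) - G1 (Function.update x 1 0) =
      -(γ (x 3) * (a (x 3) / (1 - a (x 3) * x 2 * x 0))) := by
    rw [hG1]
    simp only [Function.update_self, Function.update_of_ne h01, Function.update_of_ne h21,
      Function.update_of_ne h31, mul_one, mul_zero, neg_zero, zero_div, sub_zero, neg_div, mul_neg]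
  have hsum : D0 x + D1 x = 0 := by rw [hD0, hD1]; simp only; ring
  simp only [Fin.sum_univ_two, Matrix.cons_val_zero, Matrix.cons_val_one, hq0i, hq1i, hI0, hI1, hface0, hface1]
  linear_combination hsum

end Summit.KontsevichZagierPeriods.KontsevichZagierPeriods.Cruxes.StokesGeneration.FibrewiseStokes

end
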